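import Summits.QuantumFields.BalabanUV.Beta.WardMixedWardModel
import Summits.QuantumFields.BalabanUV.Beta.SpineRecursiveT2AllModels
import Summits.QuantumFields.BalabanUV.Beta.WardLocusParityLevels

/-!
# `BalabanUV.Beta.WardMixedJointModel` — binder row D1, (L4): **A JOINT hR∕hW MODEL OF THE MIXED SOCKETS** — `Mjoint := stepB×4 from the Ward model MW`
# solves all four hR mixed letters with ZERO residual AND the hW level-0 mixed Ward letter (W-M₀) EXACTLY; hR with no letter hypothesis and hW from the
# two border Ward letters alone, for ONE literal (β sub-cell, D1 formalisation swarm, unit `b2b-balaban-beta-d1-formalise-leaf-06`, gen 4;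
# «D1-hRhW-MIXED-JOINT-MODEL» part C2)

HONEST FRAMING (cell charter, verbatim): «discharging `BetaPertH` makes Bałaban's UV stability UNCONDITIONAL — a real constructive-QFT
result; it is NOT the continuum limit and NOT the Clay problem.»  HONEST DEPENDENCY (verbatim): «continuum YM on T⁴ ⇐ BetaPertH ∧ nine spine
estimates (0/9 proved); BetaPertH ⇐ (D1) ∧ (D4) ∧ CAP+tail; G-an2-4 gates asym, D1 and NE2/3/4.»  [our object] one data definition (`Mjoint`) and
[folklore] algebra over the row-D1 owner's `actB`∕`stepB`∕`Dmix` (K-L1∕K-M1), leaf-04's junction algebra `WardBorderReflection.ward_stepB` (p223076), this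
seat's parts B∕C1 (`WardMixedConsistency.mixed_consistency`, `WardMixedWardModel.MW`∕`ward_MW`), the hR END `…_of_letters_antiTwin` (K-G) exactly as the
owner's K-M2 uses it, and leaf-06's hW END `WardLocusParityLevels.…_TW_su_exact₀` BY NAME.  No statement of Bałaban's papers, no `[cite:]`, no `def … : Prop`;
`Mjoint` is a MODEL of two typed sockets — NOT Bałaban's `mixFFAt` (an1∕an3's (M₀) remains the row's letter); instantiates NO binder of the β-function wall
(0/4: hW, hR, D1Tel, D1Rep).  NOT D1, NOT `BetaPertH`, NOT continuum, NOT Clay.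

WHAT (`d + 1 = 4`, odd `Lc`, centred root `ρ_c`).
* §1 the `LocStencilFM` class and the mixed block-translation law under the owner's reflection action `actB` and step `stepB`
  (`locStencilFM_actB`∕`_stepB`, `translateFM_actB`∕`_stepB`; the mixed twins of K-L2c's `locStencil₂_actB` &c.).
* §2 **`Mjoint Lc cΛ := stepB Lc 3 (Dmix 3) (stepB Lc 2 (Dmix 2) (stepB Lc 1 (Dmix 1) (stepB Lc 0 (Dmix 0) (MW Lc cΛ))))`** (K-L2b's `Twall` pattern
  started at the Ward model instead of `0`); **`Mjoint_solves`** (all four axes, by `stepB_solves_self∕_other` + `actB_Dmix`), **`mixedPrim_Mjoint`**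
  ((M₀) with residual `0`), **`ward_Mjoint`** ((W-M₀) EXACTLY, by leaf-04's `ward_stepB` ×4 fed with `ward_MW` and `mixed_consistency`),
  `locStencilFM_Mjoint`, `Mjoint_translate`.
* §3 THE TWO ENDs FOR ONE LITERAL `JsRecWAtOf (… T_W …) (locStencil₂_vh₂SModel …) (locStencilFM_Mjoint …)`: **`axisReflectionCovariant_…_jointModels`**
  (hR, NO letter hypothesis — K-M2's proof with `Mmodel ↦ Mjoint`) and **`wardTransversal_…_jointModels_of_border_laws`** (hW ⟸ EXACTLY the two level-0
  BORDER Ward letters (W-B₀)∕(W-B₀″) of the model border table — the MIXED Ward letter is DISCHARGED with `RM₀ := 0`).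
HONEST: the border Ward letters of `vh₂SModel` are NOT claimed (leaf-04's parts 1–2 + an2's K-L decide them); 0∕4 binders.
Provenance: D1 formalisation swarm, leaf prover 06 (gen 4), 2026-08-20; no existing file touched.
-/

noncomputable section

open Finset
open scoped BigOperators
open Literature.MathematicalPhysics.QuantumFieldTheory
open Literature.MathematicalPhysics.QuantumFieldTheory.Balaban1983to89
open Literature.MathematicalPhysics.QuantumFieldTheory.Balaban1983to89.Beta
open B12Sec2to5 (l1 l1_nonneg)
open ExpKernelCalculus (MKer comp BiLoc shiftK)
open KernelWard (divV biLoc_add biLoc_recentre)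
open AffineAveraging (Site box toSite unitVec)
open AveragingContoursRooted (ctr ctrOff ctrOff_mem_box)
open AveragingHessianKernelsRooted (hessFFAt vhSAt)
open OneStepResolventKernel (Fib)
open OneStepKernelFamily (TbalOf flipK)
open BalabanStepJetsSucc (wE wVH)
open BalabanStepW2 (M2Of wV4 wM1 wM2)
open BalabanCompositeJets (LocStencil₂)
open SecondOrderResponse (LocStencilFM)
open StepJetData (biLoc_weaken biLoc_smul)
open PolarizationSign (reflSign axisReflect AxisReflectionCovariant WardTransversal)
open KernelReflection (LegMap refK refK_apply)
open ResolventReflection (sref bref bref_apply bref_add axisReflect_zsmul Φ reflSign_mul_self)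
open ColourTrace (Complete TrOrthonormal)
open WilsonVertex2Sym (wsym22)
open HessKerRate (biLoc_zero)
open Summit.QuantumFields.BalabanUV.Beta.TameKernelCalculus
open Summit.QuantumFields.BalabanUV.Beta.ChartConjugation (conjV)
open Summit.QuantumFields.BalabanUV.Beta.BorderedHessian (diagK ctGen bhKStepAt_zero stepScale)
open Summit.QuantumFields.BalabanUV.Beta.AveragingWardRootedStencils (legInd)
open Summit.QuantumFields.BalabanUV.Beta.SpineRooted (M1At JsRecWAtOf axisReflectionCovariant_flipK_TbalOf_JsRecWAtOf_of_letters_antiTwin)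
open Summit.QuantumFields.BalabanUV.Beta.E3LevelOneReflection (biLoc_refK_Φ)
open Summit.QuantumFields.BalabanUV.Beta.VertexSandwichTransport (l1_sref_bref_sub_le)
open Summit.QuantumFields.BalabanUV.Beta.SpineRecursiveParity (parityOdd_zero)
open Summit.QuantumFields.BalabanUV.Beta.SecondOrderBorderGauge (actB actB_smul letter_iff_actB)
open Summit.QuantumFields.BalabanUV.Beta.SecondOrderBorderCocycle (stepB stepB_solves_self stepB_solves_other)
open Summit.QuantumFields.BalabanUV.Beta.SecondOrderBorderClassKit (abs_reflSign axisReflect_neg refK_shiftK)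
open Summit.QuantumFields.BalabanUV.Beta.WilsonReflectionContact2 (wilsonW₂_bref_ff_canon_bhKAt)
open Summit.QuantumFields.BalabanUV.Beta.ColourBasisSU (suGen suGen_complete suGen_trOrthonormal diagIndex ne_zero_of_two_le)
open Summit.QuantumFields.BalabanUV.Beta.SecondOrderLetterLevels (MixedPrim levels border_all_of_prim border_prim_of_zero mixed_all_of_prim
  locStencilFM_levels parityOdd_levels)
open Summit.QuantumFields.BalabanUV.Beta.SecondOrderBorderModel (vh₂SModel borderAt_zero_vh₂SModel vh₂SModel_inl_inl vh₂SModel_inr_inr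
  vh₂SModel_antiTwin)
open Summit.QuantumFields.BalabanUV.Beta.SecondOrderBorderModelClass (locStencil₂_vh₂SModel vh₂SModel_translate)
open Summit.QuantumFields.BalabanUV.Beta.SecondOrderMixedModel (Dmix actB_Dmix locStencilFM_Dmix Dmix_translate)
open Summit.QuantumFields.BalabanUV.Beta.WardBorderReflection (ward_stepB)
open Summit.QuantumFields.BalabanUV.Beta.WardMixedConsistency (mixed_consistency)
open Summit.QuantumFields.BalabanUV.Beta.WardMixedWardModel (MW ward_MW locStencilFM_MW MW_translate)

namespace Summit.QuantumFields.BalabanUV.Beta.WardMixedJointModel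

/-! ## §1 The `LocStencilFM` class and the mixed translation law under `actB` ∕ `stepB` -/

section KitFM

variable {d : ℕ}

/-- [folklore] Reflecting a fine bond base and a coarse bond base changes `|u − N•w|₁` by at most `2N` (`N ≥ 1`). -/
theorem l1_sub_smul_le_bref {N : ℕ} (hN : 1 ≤ N) (α κ μ : Fin (d + 1)) (u w : Fin (d + 1) → ℤ) :
    l1 (u - (N : ℤ) • w) ≤ l1 (bref α κ u - (N : ℤ) • bref α μ w) + 2 * N := by
  have key : ∀ i, |(((u - (N : ℤ) • w) i : ℤ) : ℝ)| ≤ |(((bref α κ u - (N : ℤ) • bref α μ w) i : ℤ) : ℝ)| + if i = α then 2 * (N : ℝ) else 0 := by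
    intro i
    rw [Pi.sub_apply, Pi.sub_apply, Pi.smul_apply, Pi.smul_apply, smul_eq_mul, smul_eq_mul, bref_apply, bref_apply]
    by_cases hi : i = α
    · simp only [hi, if_true]
      have hc : |((((N : ℤ) - 1 - (if κ = α then 1 else 0) + (N : ℤ) * (if μ = α then 1 else 0) : ℤ)) : ℝ)| ≤ 2 * (N : ℝ) := by
        have hN' : (1 : ℤ) ≤ N := by exact_mod_cast hN
        have hz : |((N : ℤ) - 1 - (if κ = α then 1 else 0) + (N : ℤ) * (if μ = α then 1 else 0) : ℤ)| ≤ 2 * (N : ℤ) := by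
          rw [abs_le]; constructor <;> split_ifs <;> nlinarith
        rw [← Int.cast_abs]; exact_mod_cast hz
      have e : (((u α - (N : ℤ) * w α : ℤ)) : ℝ) =
          -((((-1 - u α - (if κ = α then 1 else 0)) - (N : ℤ) * (-1 - w α - (if μ = α then 1 else 0)) : ℤ) : ℝ)) +
            ((((N : ℤ) - 1 - (if κ = α then 1 else 0) + (N : ℤ) * (if μ = α then 1 else 0) : ℤ)) : ℝ) := by
        push_cast; ring
      rw [e]
      exact (abs_add_le _ _).trans (by rw [abs_neg]; linarith)
    · simp [hi]
  calc l1 (u - (N : ℤ) • w) = ∑ i, |(((u - (N : ℤ) • w) i : ℤ) : ℝ)| := rfl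
    _ ≤ ∑ i, (|(((bref α κ u - (N : ℤ) • bref α μ w) i : ℤ) : ℝ)| + if i = α then 2 * (N : ℝ) else 0) := Finset.sum_le_sum fun i _ => key i
    _ = l1 (bref α κ u - (N : ℤ) • bref α μ w) + 2 * N := by rw [Finset.sum_add_distrib, Finset.sum_ite_eq' Finset.univ α]; simp [l1]

/-- [folklore] **`actB` PRESERVES `LocStencilFM`** (`N ≥ 1`, rate `δ ≥ 0`; constant `|C|·e^{(6N+2)δ}`) — the mixed twin of K-L2c's `locStencil₂_actB`. -/
theorem locStencilFM_actB {N : ℕ} (hN : 1 ≤ N) (α : Fin (d + 1))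
    {F : Fin (d + 1) → (Fin (d + 1) → ℤ) → Fin (d + 1) → (Fin (d + 1) → ℤ) → MKer (d + 1) (Fib d)} {C δ : ℝ}
    (h : LocStencilFM N F C δ) (hδ : 0 ≤ δ) : LocStencilFM N (actB N α F) (|C| * Real.exp (δ * (4 * N) + 2 * δ + δ * (2 * N))) δ := by
  intro κ u μ w
  have h0 := h κ (bref α κ u) μ (bref α μ w)
  have h1 := biLoc_refK_Φ (d := d) (N := N) hN h0 hδ α
  have h2 := biLoc_recentre h1 hδ u u
  have h3 := biLoc_smul h2 (reflSign α κ * reflSign α μ)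
  have hb1 := l1_sref_bref_sub_le α κ u
  have hb2 := l1_sub_smul_le_bref hN α κ μ u w
  refine biLoc_weaken h3 ?_ le_rfl
  rw [abs_mul, abs_reflSign, abs_reflSign, one_mul, one_mul, abs_mul, Real.abs_exp]
  have hC : 0 ≤ |C| := abs_nonneg C
  calc |C| * Real.exp (-δ * l1 (bref α κ u - (N : ℤ) • bref α μ w)) * Real.exp (δ * (4 * N)) *
        Real.exp (δ * (l1 (sref α (bref α κ u) - u) + l1 (sref α (bref α κ u) - u)))
      = |C| * Real.exp (-δ * l1 (bref α κ u - (N : ℤ) • bref α μ w) + δ * (4 * N) +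
          δ * (l1 (sref α (bref α κ u) - u) + l1 (sref α (bref α κ u) - u))) := by rw [Real.exp_add, Real.exp_add]; ring
    _ ≤ |C| * Real.exp (δ * (4 * N) + 2 * δ + δ * (2 * N) + -δ * l1 (u - (N : ℤ) • w)) :=
        mul_le_mul_of_nonneg_left (Real.exp_le_exp.2 (by nlinarith)) hC
    _ = |C| * Real.exp (δ * (4 * N) + 2 * δ + δ * (2 * N)) * Real.exp (-δ * l1 (u - (N : ℤ) • w)) := by rw [Real.exp_add]; ring

/-- [folklore] `LocStencilFM` is closed under addition. -/
theorem locStencilFM_add {N : ℕ} {F G : Fin (d + 1) → (Fin (d + 1) → ℤ) → Fin (d + 1) → (Fin (d + 1) → ℤ) → MKer (d + 1) (Fib d)} {CF CG δ : ℝ}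
    (hF : LocStencilFM N F CF δ) (hG : LocStencilFM N G CG δ) : LocStencilFM N (F + G) (CF + CG) δ := by
  intro κ u μ w
  have h := biLoc_add (hF κ u μ w) (hG κ u μ w)
  rw [← add_mul] at h
  exact h

/-- [folklore] `LocStencilFM` is closed under scalars. -/
theorem locStencilFM_smul {N : ℕ} {F : Fin (d + 1) → (Fin (d + 1) → ℤ) → Fin (d + 1) → (Fin (d + 1) → ℤ) → MKer (d + 1) (Fib d)} {C δ : ℝ}
    (hF : LocStencilFM N F C δ) (c : ℝ) : LocStencilFM N (c • F) (|c| * C) δ := by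
  intro κ u μ w
  have h := biLoc_smul (hF κ u μ w) c
  rw [← mul_assoc] at h
  exact h

/-- [folklore] **`stepB` PRESERVES `LocStencilFM`** (same rate). -/
theorem locStencilFM_stepB {N : ℕ} (hN : 1 ≤ N) (α : Fin (d + 1))
    {D T : Fin (d + 1) → (Fin (d + 1) → ℤ) → Fin (d + 1) → (Fin (d + 1) → ℤ) → MKer (d + 1) (Fib d)} {CD CT δ : ℝ}
    (hD : LocStencilFM N D CD δ) (hT : LocStencilFM N T CT δ) (hδ : 0 ≤ δ) :
    LocStencilFM N (stepB N α D T) (|(1 / 2 : ℝ)| * (CT + |CT| * Real.exp (δ * (4 * N) + 2 * δ + δ * (2 * N))) + |(-(1 / 2 : ℝ))| * CD) δ := by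
  have h := locStencilFM_add (locStencilFM_smul (locStencilFM_add hT (locStencilFM_actB hN α hT hδ)) (1 / 2 : ℝ))
    (locStencilFM_smul hD (-(1 / 2 : ℝ)))
  have e : stepB N α D T = (1 / 2 : ℝ) • (T + actB N α T) + (-(1 / 2 : ℝ)) • D := by
    unfold SecondOrderBorderCocycle.stepB; rw [neg_smul, sub_eq_add_neg]
  rw [e]; exact h

/-- [folklore] **`actB` PRESERVES THE MIXED BLOCK-TRANSLATION LAW** (fine slot by `N•t`, coarse slot by `t`). -/
theorem translateFM_actB {N : ℕ} (α : Fin (d + 1))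
    {F : Fin (d + 1) → (Fin (d + 1) → ℤ) → Fin (d + 1) → (Fin (d + 1) → ℤ) → MKer (d + 1) (Fib d)}
    (hF : ∀ (κ : Fin (d + 1)) (u : Fin (d + 1) → ℤ) (μ : Fin (d + 1)) (w t : Fin (d + 1) → ℤ),
      F κ (u + (N : ℤ) • t) μ (w + t) = shiftK (-((N : ℤ) • t)) (F κ u μ w))
    (κ : Fin (d + 1)) (u : Fin (d + 1) → ℤ) (μ : Fin (d + 1)) (w t : Fin (d + 1) → ℤ) :
    actB N α F κ (u + (N : ℤ) • t) μ (w + t) = shiftK (-((N : ℤ) • t)) (actB N α F κ u μ w) := by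
  show (reflSign α κ * reflSign α μ) • refK (Φ (d := d) N α) (F κ (bref α κ (u + (N : ℤ) • t)) μ (bref α μ (w + t))) =
    shiftK (-((N : ℤ) • t)) ((reflSign α κ * reflSign α μ) • refK (Φ (d := d) N α) (F κ (bref α κ u) μ (bref α μ w)))
  rw [bref_add, bref_add, axisReflect_zsmul, hF, show -((N : ℤ) • axisReflect α t) = axisReflect α (-((N : ℤ) • t)) by
    rw [axisReflect_neg, axisReflect_zsmul], refK_shiftK]
  rfl

/-- [folklore] **`stepB` PRESERVES THE MIXED BLOCK-TRANSLATION LAW.** -/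
theorem translateFM_stepB {N : ℕ} (α : Fin (d + 1))
    {D T : Fin (d + 1) → (Fin (d + 1) → ℤ) → Fin (d + 1) → (Fin (d + 1) → ℤ) → MKer (d + 1) (Fib d)}
    (hD : ∀ (κ : Fin (d + 1)) (u : Fin (d + 1) → ℤ) (μ : Fin (d + 1)) (w t : Fin (d + 1) → ℤ),
      D κ (u + (N : ℤ) • t) μ (w + t) = shiftK (-((N : ℤ) • t)) (D κ u μ w))
    (hT : ∀ (κ : Fin (d + 1)) (u : Fin (d + 1) → ℤ) (μ : Fin (d + 1)) (w t : Fin (d + 1) → ℤ),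
      T κ (u + (N : ℤ) • t) μ (w + t) = shiftK (-((N : ℤ) • t)) (T κ u μ w))
    (κ : Fin (d + 1)) (u : Fin (d + 1) → ℤ) (μ : Fin (d + 1)) (w t : Fin (d + 1) → ℤ) :
    stepB N α D T κ (u + (N : ℤ) • t) μ (w + t) = shiftK (-((N : ℤ) • t)) (stepB N α D T κ u μ w) := by
  funext x z a b
  simp only [SecondOrderBorderCocycle.stepB, Pi.sub_apply, Pi.add_apply, Pi.smul_apply, smul_eq_mul, ExpKernelCalculus.shiftK, hD, hT,
    translateFM_actB α hT]

end KitFM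

/-! ## §2 The joint model -/

section Joint

variable (Lc : ℕ) [NeZero Lc] (cΛ : ℝ)

/-- [our object] **THE JOINT MODEL OF THE MIXED SOCKETS**: the owner's four sequential reflection steps (K-L2b's `Twall` pattern) STARTED AT THE WARD MODEL
`MW` instead of `0` — `Mjoint := stepB 3 (Dmix 3) (stepB 2 (Dmix 2) (stepB 1 (Dmix 1) (stepB 0 (Dmix 0) MW)))` (`= Mmodel + Π_α ½(1 + actB_α) MW`). -/
def Mjoint : Fin (3 + 1) → (Fin (3 + 1) → ℤ) → Fin (3 + 1) → (Fin (3 + 1) → ℤ) → MKer (3 + 1) (Fib 3) :=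
  stepB Lc 3 (Dmix Lc cΛ 3) (stepB Lc 2 (Dmix Lc cΛ 2) (stepB Lc 1 (Dmix Lc cΛ 1) (stepB Lc 0 (Dmix Lc cΛ 0) (MW Lc cΛ))))

variable {Lc cΛ}

/-- [folklore] The mixed contact is ODD under its own axis … -/
theorem actB_Dmix_self (hLc : Odd Lc) (α : Fin (3 + 1)) : actB Lc α (Dmix Lc cΛ α) = -Dmix Lc cΛ α := by
  rw [actB_Dmix hLc, ResolventReflection.reflSign_self, neg_one_smul]

/-- [folklore] … and EVEN under the others, so the cocycle identity of `stepB_solves_other` is trivial. -/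
theorem Dmix_cocycle (hLc : Odd Lc) {α β : Fin (3 + 1)} (h : α ≠ β) :
    Dmix Lc cΛ α + actB Lc α (Dmix Lc cΛ β) = Dmix Lc cΛ β + actB Lc β (Dmix Lc cΛ α) := by
  rw [actB_Dmix hLc, actB_Dmix hLc, ResolventReflection.reflSign_of_ne (Ne.symm h), ResolventReflection.reflSign_of_ne h, one_smul, one_smul,
    add_comm]

/-- [folklore] **`Mjoint` SOLVES ALL FOUR hR MIXED REFLECTION LETTERS EXACTLY**: `actB_α Mjoint − Mjoint = Dmix_α`. -/
theorem Mjoint_solves (hLc : Odd Lc) (α : Fin (3 + 1)) : actB Lc α (Mjoint Lc cΛ) - Mjoint Lc cΛ = Dmix Lc cΛ α := by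
  have hA := actB_Dmix_self (cΛ := cΛ) hLc
  have hC : ∀ α β : Fin (3 + 1), α ≠ β → Dmix Lc cΛ α + actB Lc α (Dmix Lc cΛ β) = Dmix Lc cΛ β + actB Lc β (Dmix Lc cΛ α) :=
    fun α β h => Dmix_cocycle hLc h
  have s10 : actB Lc 0 (stepB Lc 0 (Dmix Lc cΛ 0) (MW Lc cΛ)) - stepB Lc 0 (Dmix Lc cΛ 0) (MW Lc cΛ) = Dmix Lc cΛ 0 :=
    stepB_solves_self (hA 0) _
  have s21 := stepB_solves_self (hA 1) (stepB Lc 0 (Dmix Lc cΛ 0) (MW Lc cΛ))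
  have s20 := stepB_solves_other s10 (hC 1 0 (by decide))
  have s32 := stepB_solves_self (hA 2) (stepB Lc 1 (Dmix Lc cΛ 1) (stepB Lc 0 (Dmix Lc cΛ 0) (MW Lc cΛ)))
  have s31 := stepB_solves_other s21 (hC 2 1 (by decide))
  have s30 := stepB_solves_other s20 (hC 2 0 (by decide))
  have s43 := stepB_solves_self (hA 3) (stepB Lc 2 (Dmix Lc cΛ 2) (stepB Lc 1 (Dmix Lc cΛ 1) (stepB Lc 0 (Dmix Lc cΛ 0) (MW Lc cΛ))))
  have s42 := stepB_solves_other s32 (hC 3 2 (by decide))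
  have s41 := stepB_solves_other s31 (hC 3 1 (by decide))
  have s40 := stepB_solves_other s30 (hC 3 0 (by decide))
  unfold Mjoint
  fin_cases α
  · exact s40
  · exact s41
  · exact s42
  · exact s43

/-- [folklore] **`Mjoint` SATISFIES THE hR MIXED LETTER (M₀) WITH ZERO RESIDUAL** (an3's `MixedPrim`, K-I's hM2 at `j := 0`, VERBATIM). -/
theorem mixedPrim_Mjoint (hLc : Odd Lc) (cΛ : ℝ) : MixedPrim Lc (toSite (ctrOff 4 Lc)) cΛ (Mjoint Lc cΛ) (fun _ _ _ _ _ => 0) := by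
  intro α κ u ρ' w
  have hsol := Mjoint_solves (cΛ := cΛ) hLc α
  have e := congrFun (congrFun (congrFun (congrFun hsol κ) u) ρ') w
  simp only [Pi.sub_apply] at e
  funext x z a b
  have h2 := (letter_iff_actB Lc α (Mjoint Lc cΛ) (Dmix Lc cΛ α) κ u ρ' w a b).2 (fun x z => by rw [e]) x z
  rw [add_zero]
  exact h2

/-- [folklore] **`Mjoint` SATISFIES THE hW MIXED WARD LETTER (W-M₀) EXACTLY** (odd `Lc`): leaf-04's `ward_stepB` four times, fed with `ward_MW` (C1) and the
mixed consistency identity `mixed_consistency` (B). -/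
theorem ward_Mjoint (hLc : Odd Lc) (Y : Fin (3 + 1) → ℤ) (ρ' : Fin (3 + 1)) (w : Fin (3 + 1) → ℤ) :
    (stepScale 3 Lc 0 * (Lc : ℝ) ^ (3 + 1))⁻¹ • ∑ v ∈ box (3 + 1) Lc,
        divV (fun κ u => wM2 3 Lc 0 • Mjoint Lc cΛ κ u ρ' w) ((Lc : ℤ) • Y + toSite v) =
      comp (M1At 3 Lc (toSite (ctrOff (3 + 1) Lc)) cΛ 0 ρ' w)
          (diagK (((1 : ℝ) / 2) • ∑ v ∈ box (3 + 1) Lc, legInd (toSite (ctrOff (3 + 1) Lc)) ((Lc : ℤ) • Y + toSite v))) -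
        comp (diagK (((1 : ℝ) / 2) • ∑ v ∈ box (3 + 1) Lc, legInd (toSite (ctrOff (3 + 1) Lc)) ((Lc : ℤ) • Y + toSite v)))
          (M1At 3 Lc (toSite (ctrOff (3 + 1) Lc)) cΛ 0 ρ' w) := by
  set F : (Fin (3 + 1) → ℤ) → Fin (3 + 1) → (Fin (3 + 1) → ℤ) → MKer (3 + 1) (Fib 3) := fun Y ρ' w =>
    comp (M1At 3 Lc (toSite (ctrOff (3 + 1) Lc)) cΛ 0 ρ' w)
        (diagK (((1 : ℝ) / 2) • ∑ v ∈ box (3 + 1) Lc, legInd (toSite (ctrOff (3 + 1) Lc)) ((Lc : ℤ) • Y + toSite v))) -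
      comp (diagK (((1 : ℝ) / 2) • ∑ v ∈ box (3 + 1) Lc, legInd (toSite (ctrOff (3 + 1) Lc)) ((Lc : ℤ) • Y + toSite v)))
        (M1At 3 Lc (toSite (ctrOff (3 + 1) Lc)) cΛ 0 ρ' w) with hF
  have hW0 : ∀ (Y : Fin (3 + 1) → ℤ) (ρ' : Fin (3 + 1)) (w : Fin (3 + 1) → ℤ),
      (stepScale 3 Lc 0 * (Lc : ℝ) ^ (3 + 1))⁻¹ • ∑ v ∈ box (3 + 1) Lc,
        divV (fun κ u => wM2 3 Lc 0 • MW Lc cΛ κ u ρ' w) ((Lc : ℤ) • Y + toSite v) = F Y ρ' w := fun Y ρ' w => ward_MW hLc.pos Y ρ' w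
  have hC : ∀ (α : Fin (3 + 1)) (Y : Fin (3 + 1) → ℤ) (ρ' : Fin (3 + 1)) (w : Fin (3 + 1) → ℤ),
      (stepScale 3 Lc 0 * (Lc : ℝ) ^ (3 + 1))⁻¹ • ∑ v ∈ box (3 + 1) Lc,
          divV (fun κ u => wM2 3 Lc 0 • Dmix Lc cΛ α κ u ρ' w) ((Lc : ℤ) • Y + toSite v) =
        reflSign α ρ' • refK (Φ (d := 3) Lc α) (F (sref α Y) ρ' (bref α ρ' w)) - F Y ρ' w := fun α Y ρ' w => mixed_consistency hLc cΛ α Y ρ' w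
  have h1 := fun Y ρ' w => ward_stepB (hW0) (hC 0) Y ρ' w
  have h2 := fun Y ρ' w => ward_stepB h1 (hC 1) Y ρ' w
  have h3 := fun Y ρ' w => ward_stepB h2 (hC 2) Y ρ' w
  have h4 := fun Y ρ' w => ward_stepB h3 (hC 3) Y ρ' w
  exact h4 Y ρ' w

/-- [folklore] **`Mjoint` IS A `LocStencilFM` FAMILY** (`hmix`). -/
theorem locStencilFM_Mjoint (hLc : Odd Lc) (cΛ : ℝ) : ∃ C δ : ℝ, 0 < δ ∧ LocStencilFM Lc (Mjoint Lc cΛ) C δ := by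
  -- a common rate: the Ward model's `1/5` capped by the contact's `1/4`
  obtain ⟨C0, δ0, hδ0, h0⟩ := locStencilFM_MW hLc.pos cΛ
  obtain ⟨D0, hD0⟩ := locStencilFM_Dmix hLc cΛ 0
  obtain ⟨D1, hD1⟩ := locStencilFM_Dmix hLc cΛ 1
  obtain ⟨D2, hD2⟩ := locStencilFM_Dmix hLc cΛ 2
  obtain ⟨D3, hD3⟩ := locStencilFM_Dmix hLc cΛ 3
  set δ := min δ0 (1 / 4) with hδ
  have hδpos : 0 < δ := lt_min hδ0 (by norm_num)
  have hδ' : 0 ≤ δ := hδpos.le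
  have wk : ∀ {F : Fin (3 + 1) → (Fin (3 + 1) → ℤ) → Fin (3 + 1) → (Fin (3 + 1) → ℤ) → MKer (3 + 1) (Fib 3)} {C δ' : ℝ},
      LocStencilFM Lc F C δ' → δ ≤ δ' → LocStencilFM Lc F (|C|) δ := by
    intro F C δ' h hle κ u μ w x z a b
    have h1 := h κ u μ w x z a b
    have hC : 0 ≤ C := by
      have := (h 0 0 0 0).nonneg (Sum.inl 0); simp [l1] at this; exact this
    refine h1.trans ?_
    rw [abs_of_nonneg hC, mul_assoc, mul_assoc, ← Real.exp_add, ← Real.exp_add]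
    exact mul_le_mul_of_nonneg_left (Real.exp_le_exp.2 (by nlinarith [l1_nonneg (u - (Lc : ℤ) • w), l1_nonneg (x - u), l1_nonneg (z - u)])) hC
  have hT0 := wk h0 (min_le_left _ _)
  have e0 := wk hD0 (min_le_right _ _)
  have e1 := wk hD1 (min_le_right _ _)
  have e2 := wk hD2 (min_le_right _ _)
  have e3 := wk hD3 (min_le_right _ _)
  have hL1 : 1 ≤ Lc := hLc.pos
  exact ⟨_, δ, hδpos, locStencilFM_stepB hL1 3 e3 (locStencilFM_stepB hL1 2 e2 (locStencilFM_stepB hL1 1 e1 (locStencilFM_stepB hL1 0 e0 hT0 hδ') hδ') hδ') hδ'⟩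

/-- [folklore] **`Mjoint` IS BLOCK-TRANSLATION COVARIANT** (`hmixt`). -/
theorem Mjoint_translate (hLc : Odd Lc) (cΛ : ℝ) (κ : Fin (3 + 1)) (u : Fin (3 + 1) → ℤ) (μ : Fin (3 + 1)) (w t : Fin (3 + 1) → ℤ) :
    Mjoint Lc cΛ κ (u + (Lc : ℤ) • t) μ (w + t) = shiftK (-((Lc : ℤ) • t)) (Mjoint Lc cΛ κ u μ w) := by
  have hD := fun α => Dmix_translate (cΛ := cΛ) hLc (α := α)
  unfold Mjoint
  exact translateFM_stepB 3 (hD 3) (translateFM_stepB 2 (hD 2) (translateFM_stepB 1 (hD 1) (translateFM_stepB 0 (hD 0)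
    (fun κ u μ w t => MW_translate κ u μ w t)))) κ u μ w t

end Joint

/-! ## §3 The two ENDs for ONE literal: border table `vh₂SModel`, mixed table `Mjoint` -/

section Ends

variable {Lc : ℕ} [NeZero Lc]

/-- [folklore] **hR FOR THE JOINTLY-MODELLED WALL LITERAL, NO LETTER HYPOTHESIS** (general colour basis; K-M2's
`SpineRecursiveT2AllModels.axisReflectionCovariant_flipK_TbalOf_JsRecWAtOf_models` with the mixed table `Mmodel ↦ Mjoint`): the recursive wall at
`T := (8N²)⁻¹•wsym22 N`, `vh₂S := vh₂SModel Lc cΛ cB γ`, `mixFF := Mjoint Lc cΛ` is axis-reflection covariant at every level, from odd `Lc`, the colour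
data, `cB ≠ 0`, `γ`∕`hγ` and lock2 ONLY. -/
theorem axisReflectionCovariant_flipK_TbalOf_JsRecWAtOf_jointModels (hLc : Odd Lc) {N : ℕ} {C : Type*} [Fintype C] [DecidableEq C]
    {τ : C → Matrix (Fin N) (Fin N) ℂ} (hτ : Complete τ) (ho : TrOrthonormal τ) (hN : N ≠ 0) (c : C) (cΛ cE₂ cB : ℝ) (hcB : cB ≠ 0)
    (γ : ℕ → ℝ) (hγ : ∀ j, γ j = -((Lc : ℝ) ^ 8 / 2) * wVH 3 Lc j / (stepScale 3 Lc j * (Lc : ℝ) ^ 4))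
    (hlock2 : ∀ j, cE₂ * wV4 3 Lc (j + 1) * wVH 3 Lc (j + 1) = ((Lc : ℝ) ^ 4 * wE 3 Lc (j + 1)) ^ 2) :
    ∀ j : ℕ, AxisReflectionCovariant
      (flipK (TbalOf Lc (JsRecWAtOf (d := 3) hLc.pos (ctrOff_mem_box hLc.pos) ((Lc : ℝ) ^ 4) (-((Lc : ℝ) ^ 8 / 2)) cΛ cE₂ cB
        ((8 * (N : ℝ) ^ 2)⁻¹ • wsym22 N) (locStencil₂_vh₂SModel hLc cΛ cB γ) (locStencilFM_Mjoint hLc cΛ)) j)) :=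
  axisReflectionCovariant_flipK_TbalOf_JsRecWAtOf_of_letters_antiTwin hLc cΛ cE₂ cB ((8 * (N : ℝ) ^ 2)⁻¹ • wsym22 N)
    (locStencil₂_vh₂SModel hLc cΛ cB γ) (vh₂SModel_inl_inl cΛ cB γ) (locStencilFM_Mjoint hLc cΛ) γ hγ hlock2
    (levels Lc (fun _ _ _ _ _ => 0)) (fun _ _ _ _ _ => 0)
    (fun α κ u κ' u' x z β β' => by
      simpa only [Pi.zero_apply, add_zero, bhKStepAt_zero] using
        wilsonW₂_bref_ff_canon_bhKAt (d := 3) hτ ho hN c (toSite (ctrOff 4 Lc)) Lc Lc α κ κ' u u' x z β β')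
    (fun _ _ _ _ _ _ _ _ _ => rfl) (fun _ _ _ _ _ _ _ _ _ => rfl)
    (fun _ => ⟨0, 1, one_pos, fun κ u κ' u' => by simpa using (biLoc_zero u u (1 : ℝ) : BiLoc (0 : MKer 4 (Fib 3)) u u 0 1)⟩)
    (fun _ _ _ _ _ => parityOdd_zero)
    (mixed_all_of_prim (toSite (ctrOff 4 Lc)) cΛ hγ (mixedPrim_Mjoint hLc cΛ))
    (locStencilFM_levels fun _ => ⟨0, 1, one_pos, fun κ u ρ w => by simpa using (biLoc_zero u u (1 : ℝ) : BiLoc (0 : MKer 4 (Fib 3)) u u 0 1)⟩)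
    (parityOdd_levels fun _ _ _ _ _ => parityOdd_zero)
    (vh₂SModel_antiTwin cΛ cB γ) (vh₂SModel_inr_inr cΛ cB γ)
    (border_all_of_prim (toSite (ctrOff 4 Lc)) cΛ cB hγ
      (border_prim_of_zero (toSite (ctrOff 4 Lc)) cΛ cB hγ (borderAt_zero_vh₂SModel hLc cΛ cB hcB γ hγ)))
    (vh₂SModel_translate hLc cΛ cB γ) (Mjoint_translate hLc cΛ)

/-- [folklore] **THE `SU(N)` INSTANCE, `N ≥ 2`** of the hR END for the jointly-modelled literal. -/
theorem axisReflectionCovariant_flipK_TbalOf_JsRecWAtOf_jointModels_suN (hLc : Odd Lc) {N : ℕ} (hN : 2 ≤ N) (cΛ cE₂ cB : ℝ) (hcB : cB ≠ 0)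
    (γ : ℕ → ℝ) (hγ : ∀ j, γ j = -((Lc : ℝ) ^ 8 / 2) * wVH 3 Lc j / (stepScale 3 Lc j * (Lc : ℝ) ^ 4))
    (hlock2 : ∀ j, cE₂ * wV4 3 Lc (j + 1) * wVH 3 Lc (j + 1) = ((Lc : ℝ) ^ 4 * wE 3 Lc (j + 1)) ^ 2) :
    ∀ j : ℕ, AxisReflectionCovariant
      (flipK (TbalOf Lc (JsRecWAtOf (d := 3) hLc.pos (ctrOff_mem_box hLc.pos) ((Lc : ℝ) ^ 4) (-((Lc : ℝ) ^ 8 / 2)) cΛ cE₂ cB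
        ((8 * (N : ℝ) ^ 2)⁻¹ • wsym22 N) (locStencil₂_vh₂SModel hLc cΛ cB γ) (locStencilFM_Mjoint hLc cΛ)) j)) :=
  axisReflectionCovariant_flipK_TbalOf_JsRecWAtOf_jointModels hLc (suGen_complete (ne_zero_of_two_le hN)) (suGen_trOrthonormal N)
    (ne_zero_of_two_le hN) (diagIndex hN) cΛ cE₂ cB hcB γ hγ hlock2

/-- [folklore] **hW FOR THE SAME LITERAL ⟸ EXACTLY THE TWO LEVEL-0 BORDER WARD LETTERS OF THE MODEL BORDER TABLE** (every `SU(N)`, `N ≥ 2`, odd `Lc`,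
pin `cE₂ = Lc^{2(3+1)}`): leaf-06's hW END `WardLocusParityLevels.…_TW_su_exact₀` at `vh₂S := vh₂SModel Lc cΛ cB γ`, `mixFF := Mjoint Lc cΛ`, with the
MIXED Ward letter hM₂0 DISCHARGED by `ward_Mjoint` (`RM₀ := 0`, class and parity trivial) and `hB`∕`hBt`∕`hmix`∕`hmixt` by the model lemmas; the border
Ward letters (W-B₀) `hBord0` ∕ (W-B₀″) `hBord0''` of `vh₂SModel` are NOT claimed (leaf-04's parts 1–2 decide them).  Literal spelt as in the hW END
(`cVH = −(Lc⁴·½·Lc⁴)`, root `ctrOff (3+1) Lc`); the hR END's spelling `−(Lc⁸∕2)` is the same real number. -/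
theorem wardTransversal_flipK_TbalOf_JsRecWAtOf_jointModels_of_border_laws (hLc : Odd Lc) {N : ℕ} (hN : 2 ≤ N) (cΛ cB : ℝ) {cE₂ : ℝ}
    (hcE₂ : cE₂ = (Lc : ℝ) ^ (2 * (3 + 1))) (γ : ℕ → ℝ)
    (hBord0 : ∀ (Y : Fin (3 + 1) → ℤ) (κ' : Fin (3 + 1)) (u' : Fin (3 + 1) → ℤ),
      (stepScale 3 Lc 0 * (Lc : ℝ) ^ (3 + 1))⁻¹ • ∑ v ∈ box (3 + 1) Lc,
          divV (fun κ u => cB • vh₂SModel Lc cΛ cB γ κ u κ' u') ((Lc : ℤ) • Y + toSite v) =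
        comp ((-((Lc : ℝ) ^ (3 + 1) * (1 / 2) * (Lc : ℝ) ^ (3 + 1))) • vhSAt (toSite (ctrOff (3 + 1) Lc)) 3 Lc rfl κ' u')
            (diagK (((1 : ℝ) / 2) • ∑ v ∈ box (3 + 1) Lc, legInd (toSite (ctrOff (3 + 1) Lc)) ((Lc : ℤ) • Y + toSite v))) -
          comp (diagK (((1 : ℝ) / 2) • ∑ v ∈ box (3 + 1) Lc, legInd (toSite (ctrOff (3 + 1) Lc)) ((Lc : ℤ) • Y + toSite v)))
            ((-((Lc : ℝ) ^ (3 + 1) * (1 / 2) * (Lc : ℝ) ^ (3 + 1))) • vhSAt (toSite (ctrOff (3 + 1) Lc)) 3 Lc rfl κ' u'))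
    (hBord0'' : ∀ (Y : Fin (3 + 1) → ℤ) (κ : Fin (3 + 1)) (u : Fin (3 + 1) → ℤ),
      (stepScale 3 Lc 0 * (Lc : ℝ) ^ (3 + 1))⁻¹ • ∑ v ∈ box (3 + 1) Lc,
          divV (fun κ' u' => cB • vh₂SModel Lc cΛ cB γ κ u κ' u') ((Lc : ℤ) • Y + toSite v) =
        comp ((-((Lc : ℝ) ^ (3 + 1) * (1 / 2) * (Lc : ℝ) ^ (3 + 1))) • vhSAt (toSite (ctrOff (3 + 1) Lc)) 3 Lc rfl κ u)
            (diagK (((1 : ℝ) / 2) • ∑ v ∈ box (3 + 1) Lc, legInd (toSite (ctrOff (3 + 1) Lc)) ((Lc : ℤ) • Y + toSite v))) -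
          comp (diagK (((1 : ℝ) / 2) • ∑ v ∈ box (3 + 1) Lc, legInd (toSite (ctrOff (3 + 1) Lc)) ((Lc : ℤ) • Y + toSite v)))
            ((-((Lc : ℝ) ^ (3 + 1) * (1 / 2) * (Lc : ℝ) ^ (3 + 1))) • vhSAt (toSite (ctrOff (3 + 1) Lc)) 3 Lc rfl κ u)) :
    ∀ j : ℕ, WardTransversal (flipK (TbalOf Lc
      (JsRecWAtOf (d := 3) hLc.pos (ctrOff_mem_box hLc.pos) ((Lc : ℝ) ^ (3 + 1)) (-((Lc : ℝ) ^ (3 + 1) * (1 / 2) * (Lc : ℝ) ^ (3 + 1))) cΛ cE₂ cB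
        ((8 * (N : ℝ) ^ 2)⁻¹ • wsym22 N) (locStencil₂_vh₂SModel hLc cΛ cB γ) (locStencilFM_Mjoint hLc cΛ)) j)) :=
  WardLocusParityLevels.wardTransversal_flipK_TbalOf_JsRecWAtOf_TW_su_exact₀ hN hLc.pos (ctrOff_mem_box hLc.pos) cΛ cB hcE₂
    (locStencil₂_vh₂SModel hLc cΛ cB γ) (vh₂SModel_translate hLc cΛ cB γ) (locStencilFM_Mjoint hLc cΛ) (Mjoint_translate hLc cΛ)
    (RM₀ := fun _ _ _ => 0) ⟨0, 1, one_pos, fun y ρ' w => by simpa using (biLoc_zero ((Lc : ℤ) • w) ((Lc : ℤ) • w) (1 : ℝ) :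
      BiLoc (0 : MKer (3 + 1) (Fib 3)) ((Lc : ℤ) • w) ((Lc : ℤ) • w) 0 1)⟩
    (fun _ _ _ => parityOdd_zero) hBord0 hBord0'' (fun y ρ' w => by rw [add_zero]; exact ward_Mjoint hLc y ρ' w)

end Ends

end Summit.QuantumFields.BalabanUV.Beta.WardMixedJointModel

end
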